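import Literature.NumberTheory.EllipticCurves.IsogenyTwoTorsionProofs
import Literature.NumberTheory.EllipticCurves.IsogenyMordellWeilRankProofs
import Literature.NumberTheory.EllipticCurves.TwoIsogenySelmerGroupRankProofs
import Literature.NumberTheory.EllipticCurves.BSDInvariantsProofs
import HarnessLib

/-!
# Rank-2 observatory — KERNEL-TRANSPORT instrument: `rank_ℤ` carried along the rational `2`-isogeny

HONEST FRAMING: per-curve certified theorems and census instruments; no claim on BSD in rank ≥ 2.

The generic step of the KERNEL-TRANSPORT instrument (cert-3, gen 12). A census model `E` with one rational
point of order `2` is taken by an admissible change of variables `C` to the `2`-torsion normal form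
`E_{a,b} : y² = x³ + a x² + b x` (`b (a² - 4b) ≠ 0`); the tree's explicit `2`-isogeny
(`WeierstrassCurve.twoIsogeny`, `isIsogenous_twoIsogenyCodomain`, `IsogenyTwoTorsionProofs.lean`) maps it onto
`E₂ = E_{-2a, a²-4b}`; and the tree's PROVED isogeny invariance of the Mordell–Weil rank over a field of
characteristic `0` (`WeierstrassCurve.IsIsogenous.mordellWeilRank_eq`, `IsogenyMordellWeilRankProofs.lean`) together
with the PROVED invariance under admissible changes of variables (`mordellWeilRank_variableChange_holds`,
`BSDInvariantsProofs.lean`) give `rank_ℤ E(ℚ) = rank_ℤ E'(ℚ)` for ANY model `E'` with `C' • E' = E₂`.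
Use: the `39` rank-2 census rows with torsion `ℤ/2` or `ℤ/4` whose descent via `2`-isogeny is not sharp
(`#S^(φ)·#S^(φ̂) = 64`, the `Ш[φ]`-obstructed rows skipped by KERNEL-ISO) but whose `2`-isogenous class-mate has
full rational `2`-torsion and is certified `rank_ℤ = 2` by the kernel `2`-descent of KERNEL-HUP
(`Rank2Observatory<label>RankTwo.lean`); per-curve files `Rank2Observatory<label>RankTwo.lean` instantiate
`mordellWeilRank_eq_of_twoIsogenyTransport` with the two explicit changes of variables.
No definitions; no `decide`; axioms `propext`, `Classical.choice`, `Quot.sound`.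

## References
* J. H. Silverman, *The Arithmetic of Elliptic Curves*, 2nd ed. (2009), III.4.5 (the `2`-isogeny), III.6.1–6.2,
  VIII.6 and III.3.1(b). [cite: SilvermanAEC2009, III.6.2 and VIII.6]
* J. S. Milne, *Arithmetic Duality Theorems*, 2nd ed. (2006), proof of Thm. I.7.3 (p. 97). [cite: MilneADT2006, proof of Thm. I.7.3 (p. 97)]
* J. H. Silverman, J. Tate, *Rational Points on Elliptic Curves*, 2nd ed. (2015), §3.4–§3.5. [cite: SilvermanTate2015, §3.4]
-/

-- single-conjunct summit: `Summit.BirchSwinnertonDyer.BirchSwinnertonDyer.…` repeats the name by design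
set_option linter.dupNamespace false

noncomputable section

namespace Summit.BirchSwinnertonDyer.BirchSwinnertonDyer.Rank2Observatory

open WeierstrassCurve Literature.NumberTheory.EllipticCurves

/-- **`rank_ℤ E_{a,b}(ℚ) = rank_ℤ E_{-2a, a²-4b}(ℚ)`** for `a, b ∈ ℤ` with `b (a² - 4b) ≠ 0`: the two curves are
`2`-isogenous over `ℚ` (`isIsogenous_twoIsogenyCodomain`) and isogenous elliptic curves over a field of characteristic
`0` have the same Mordell–Weil rank (`IsIsogenous.mordellWeilRank_eq`, proved in the tree).
[cite: SilvermanAEC2009, III.4.5 and III.6.2] [cite: MilneADT2006, proof of Thm. I.7.3 (p. 97)] -/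
theorem mordellWeilRank_mk_eq_twoIsogenyCodomain {a b : ℤ} (hab : b * (a ^ 2 - 4 * b) ≠ 0) :
    (⟨0, (a : ℚ), 0, (b : ℚ), 0⟩ : WeierstrassCurve ℚ).mordellWeilRank =
      (⟨0, ((-2 * a : ℤ) : ℚ), 0, ((a ^ 2 - 4 * b : ℤ) : ℚ), 0⟩ : WeierstrassCurve ℚ).mordellWeilRank := by
  haveI := isElliptic_mk_of_ne_zero (F := ℚ) hab
  have h := (isIsogenous_twoIsogenyCodomain (⟨0, (a : ℚ), 0, (b : ℚ), 0⟩ : WeierstrassCurve ℚ)).mordellWeilRank_eq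
  rwa [twoIsogenyCodomain_mk_intCast] at h

/-- **KERNEL-TRANSPORT step: `rank_ℤ E(ℚ) = rank_ℤ E'(ℚ)`** whenever admissible changes of variables take `E` to
`E_{a,b}` (`b (a² - 4b) ≠ 0`) and `E'` to the `2`-isogenous normal form `E_{-2a, a²-4b}`: invariance of `rank_ℤ` under
admissible changes of variables (`mordellWeilRank_variableChange_holds`) on both sides of
`mordellWeilRank_mk_eq_twoIsogenyCodomain`. [cite: SilvermanAEC2009, III.3.1(b), III.6.2 and VIII.6] -/
theorem mordellWeilRank_eq_of_twoIsogenyTransport (E E' : WeierstrassCurve ℚ) (a b : ℤ)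
    (hab : b * (a ^ 2 - 4 * b) ≠ 0) (C C' : VariableChange ℚ)
    (hC : C • E = ⟨0, (a : ℚ), 0, (b : ℚ), 0⟩)
    (hC' : C' • E' = ⟨0, ((-2 * a : ℤ) : ℚ), 0, ((a ^ 2 - 4 * b : ℤ) : ℚ), 0⟩) :
    E.mordellWeilRank = E'.mordellWeilRank := by
  have h₁ := mordellWeilRank_variableChange_holds E C
  rw [mordellWeilRank_variableChange, hC] at h₁
  have h₂ := mordellWeilRank_variableChange_holds E' C'
  rw [mordellWeilRank_variableChange, hC'] at h₂
  rw [← h₁, ← h₂]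
  exact mordellWeilRank_mk_eq_twoIsogenyCodomain hab

/-- The same with the roles named for the observatory: if the class-mate `E'` has `rank_ℤ E'(ℚ) = 2` then so has `E`.
[cite: SilvermanAEC2009, III.6.2 and VIII.6] -/
theorem mordellWeilRank_eq_two_of_twoIsogenyTransport (E E' : WeierstrassCurve ℚ) (a b : ℤ)
    (hab : b * (a ^ 2 - 4 * b) ≠ 0) (C C' : VariableChange ℚ)
    (hC : C • E = ⟨0, (a : ℚ), 0, (b : ℚ), 0⟩)
    (hC' : C' • E' = ⟨0, ((-2 * a : ℤ) : ℚ), 0, ((a ^ 2 - 4 * b : ℤ) : ℚ), 0⟩)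
    (hE' : E'.mordellWeilRank = 2) : E.mordellWeilRank = 2 := by
  rw [mordellWeilRank_eq_of_twoIsogenyTransport E E' a b hab C C' hC hC']
  exact hE'

end Summit.BirchSwinnertonDyer.BirchSwinnertonDyer.Rank2Observatory

end
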